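import Literature.Analysis.FluidPDE.KNSSAxisymmetricNoSwirlHolds
import Summits.NavierStokesRegularity.NavierStokesRegularity.Theorems.SymmetryModuliCountAxisymEndLiouvilleStubAxisNormalForm

/-!
# Crux `IsobaricLinesLiouville` (stmt-NavierStokesRegularity-11741), line `Ideator2Sketch`
  (card `flux-surface-persistence`): the axisymmetric no-swirl leaf `stub_axisymLeaf`

Prover-written file (theorems only; lands `--supports stmt-NavierStokesRegularity-11741`) for the
registered stub `stub_axisymLeaf` of the skeleton of the Liouville theorem for bounded ancient
Navier–Stokes solutions (`ν = 1`) with isobaric vortex lines. The stub is the AXISYMMETRIC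
NO-SWIRL LEAF of the symmetric hull: a bounded ancient mild solution, classical on `(-∞, 0)`,
whose slices `v t`, `t < 0`, are *infinitesimally* invariant under the rotations about the
`x₂`-axis (`Dv(x)[e_z × x] = e_z × v(x)`, the Lie derivative along the Killing field
`K(x) = e_z × x = (−x₁, x₀, 0)` vanishes) and have no swirl (`⟪v, e_z × x⟫ = 0`) is constant on
every slice.

Route (all ingredients are proved in the tree):
1. `e_z × w = J w` (`cross_eZ_eq_rotGen`, `J = rotGen`), so the second hypothesis is
   `swirl (v t) ≡ 0` (`swirl_eq_inner_rotGen`), i.e. `HasNoSwirl (v t)`, and the first one is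
   the infinitesimal axisymmetry `Dv(x)[J x] = J v(x)`.
2. Integration of the infinitesimal symmetry to `IsAxisymmetric (v t)`: the tree's
   `AxisymEndLiouville.AbsorbingAxisSwirlExtinction.isAxisymmetric_of_fderiv_rotGen`
   (`Theorems/SymmetryModuliCountAxisymEndLiouvilleStubAxisNormalForm.lean`), applied to the
   smooth slices (`IsClassicalNSSolutionOn.contDiff_velocity`).
3. Smooth slices are continuous, hence a.e. strongly measurable.
4. KNSS 2009, Theorem 5.2 in the tree's slice-wise `ℝ³`-valued form
   (`knss_axisymmetric_no_swirl'_holds`): `v t = b` a.e.; a continuous function a.e. equal to a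
   constant is that constant (`Continuous.ae_eq_iff_eq`, Lebesgue measure charges open sets).
-/

-- the summit-side namespace `Summit.NavierStokesRegularity.NavierStokesRegularity.…` repeats a component by design (D-0017)
set_option linter.dupNamespace false

noncomputable section

namespace Summit.NavierStokesRegularity.NavierStokesRegularity.Theorems.IsobaricLinesLiouville.FluxSurfacePersistence

open scoped InnerProductSpace RealInnerProductSpace ContDiff
open Literature.Analysis.FluidPDE Set Function MeasureTheory WithLp
open Summit.NavierStokesRegularity.NavierStokesRegularity.Theorems.AxisymEndLiouville

/-- `e_z × w = J w`: the cross product with the axial unit vector `e_z = (0, 0, 1)` is the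
infinitesimal rotation `rotGen w = (−w₁, w₀, 0)` about the `x₂`-axis. -/
theorem cross_eZ_eq_rotGen (w : EuclideanSpace ℝ (Fin 3)) : cross eZ w = rotGen w := by
  ext i
  fin_cases i <;> simp [cross, rotGen, eZ, cross_apply]

/-- **Axisymmetric no-swirl leaf** (KNSS 2009, Thm 5.2, via `knss_axisymmetric_no_swirl'_holds`):
a bounded ancient mild solution of Navier–Stokes (`ν = 1`) on `ℝ³`, classical on `(-∞, 0)`,
which at every `t < 0` is infinitesimally invariant under the rotations about the `x₂`-axis
(`Dv(x)[e_z × x] = e_z × v(x)`) and has no swirl (`⟪v, e_z × x⟫ = 0`) is constant on every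
slice: the infinitesimal symmetry integrates to `IsAxisymmetric (v t)`
(`AbsorbingAxisSwirlExtinction.isAxisymmetric_of_fderiv_rotGen`), `⟪v, e_z × x⟫` is the swirl,
smooth slices are measurable, KNSS Thm 5.2 gives `v t = b` a.e., and continuity upgrades a.e.
to everywhere. -/
theorem stub_axisymLeaf :
    ∀ (v : ℝ → (EuclideanSpace ℝ (Fin 3)) → (EuclideanSpace ℝ (Fin 3))) (q : ℝ → (EuclideanSpace ℝ (Fin 3)) → ℝ),
      IsBoundedAncientMildSolution 1 v → IsClassicalNSSolutionOn (Set.Iio 0) 1 0 v q →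
        (∀ t < 0, ∀ x : (EuclideanSpace ℝ (Fin 3)), fderiv ℝ (v t) x (cross eZ x) = cross eZ (v t x)) →
          (∀ t < 0, ∀ x : (EuclideanSpace ℝ (Fin 3)), ⟪v t x, cross eZ x⟫_ℝ = 0) →
            ∀ t < 0, ∃ b : (EuclideanSpace ℝ (Fin 3)), v t = fun _ => b := by
  intro v q hanc hcl hJ hsw t ht
  have hsmooth : ∀ s < 0, ContDiff ℝ ∞ (v s) := fun s hs => hcl.contDiff_velocity hs
  have hcont : ∀ s < 0, Continuous (v s) := fun s hs => (hsmooth s hs).continuous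
  have hmeas : ∀ s < 0, AEStronglyMeasurable (v s) volume := fun s hs =>
    (hcont s hs).aestronglyMeasurable
  have haxi : ∀ s < 0, IsAxisymmetric (v s) := fun s hs =>
    AbsorbingAxisSwirlExtinction.isAxisymmetric_of_fderiv_rotGen
      ((hsmooth s hs).differentiable (by simp)) fun x => by
        simpa only [cross_eZ_eq_rotGen] using hJ s hs x
  have hswirl : ∀ s < 0, HasNoSwirl (v s) := fun s hs x => by
    rw [swirl_eq_inner_rotGen]
    show ⟪rotGen x, v s x⟫ = 0
    rw [real_inner_comm, ← cross_eZ_eq_rotGen]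
    exact hsw s hs x
  obtain ⟨b, hb⟩ := knss_axisymmetric_no_swirl'_holds hanc hmeas haxi hswirl t ht
  exact ⟨b, (Continuous.ae_eq_iff_eq volume (hcont t ht) continuous_const).1 hb⟩

end Summit.NavierStokesRegularity.NavierStokesRegularity.Theorems.IsobaricLinesLiouville.FluxSurfacePersistence

end
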